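import Summits.CriticalPhenomena.Ising3DConformalLimit.Theorems.GaussianScaleMixtureRotationUpgradeFromTwoPointIsometries
import HarnessLib

/-!
# Crux `RotationUpgradeFromTwoPoint` (stmt-CriticalPhenomena-8367), line `two-crystals-generate-so3`:
# the symmetric-gauge hex embedding and the invariance bookkeeping (route-posited objects, `Defs`-type file)

* `zlin M` — the real-linear action on `ℝ^d` of an integer matrix, and the coordinate formula of the
  sixfold matrix `!![0,-1,0; 1,1,0; 0,0,1]` (= `stackedTriSixfold` of
  `Literature/Probability/LatticeModels/StackedTriangularIsing.lean`, by `rfl`);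
* `Inv S T` — "the correlation family `S` is invariant under the map `T` at every order and every
  configuration", with composition / inverse / extensionality and the fact that the two `B₃`
  generator families (coordinate permutations, coordinate sign flips, in the exact form of the tree's
  `limit_coordPerm` / `limit_signFlip`) give every `signedIso π ε`;
* `hexEmbed c hc : E3 ≃L[ℝ] E3` — the symmetric-gauge embedding
  `L_c (v₀,v₁,v₂) = (v₀ + v₁/2, (√3/2)v₁, c v₂)` of the stacked-triangular lattice (equilateral
  layers, vertical stacking axis, axial scale `c ≠ 0`), its inverse, and the key identity
  `hexEmbed_conj_sixfold : L_c M̃ L_c⁻¹ = R_z(60°)` (`rz60`).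
Nothing is asserted about the Ising model here.
-/

noncomputable section

open Literature.Probability.LatticeModels Finset

namespace Summit.CriticalPhenomena.Ising3DConformalLimit.Cruxes.RotationUpgradeFromTwoPoint.TwoCrystalsGenerateSo3

local notation "E3" => EuclideanSpace ℝ (Fin 3)

/-! ### Integer matrices acting on `ℝ^d` -/

/-- The real-linear action on `ℝ^d` of an integer matrix (`Matrix.toEuclideanLin` of its cast). [folklore] -/
abbrev zlin {d : ℕ} (M : Matrix (Fin d) (Fin d) ℤ) :
    EuclideanSpace ℝ (Fin d) →ₗ[ℝ] EuclideanSpace ℝ (Fin d) :=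
  Matrix.toEuclideanLin (M.map ((↑) : ℤ → ℝ))

/-- Coordinates of the real action of an integer matrix. [folklore] -/
theorem zlin_apply {d : ℕ} (M : Matrix (Fin d) (Fin d) ℤ) (v : EuclideanSpace ℝ (Fin d)) (j : Fin d) :
    zlin M v j = ∑ k, (M j k : ℝ) * v k := by
  simp [zlin, Matrix.toEuclideanLin, Matrix.toLpLin_apply, Matrix.mulVec, dotProduct]

/-- `M̃ (a,b,c) = (-b, a+b, c)`. [folklore] -/
theorem sixfold_apply (v : E3) :
    zlin !![0, -1, 0; 1, 1, 0; 0, 0, 1] v = WithLp.toLp 2 ![-(v 1), v 0 + v 1, v 2] := by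
  ext j
  rw [zlin_apply]
  fin_cases j <;> simp [Fin.sum_univ_three]

/-! ### Invariance bookkeeping -/

section Invariance

variable {S : CorrFamily 3}

/-- The invariance predicate. [folklore] -/
def Inv (S : CorrFamily 3) (T : E3 → E3) : Prop := ∀ (n : ℕ) (x : Fin n → E3), S n (fun i => T (x i)) = S n x

/-- Invariances compose. [folklore] -/
theorem Inv.comp {A B : E3 → E3} (hA : Inv S A) (hB : Inv S B) : Inv S (fun x => A (B x)) := by
  intro n x
  rw [show (fun i => A (B (x i))) = fun i => A ((fun i => B (x i)) i) from rfl, hA, hB]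

/-- Invariance passes to the inverse of an isometry. [folklore] -/
theorem Inv.symm {R : E3 ≃ₗᵢ[ℝ] E3} (hR : Inv S R) : Inv S R.symm := by
  intro n x
  have := hR n (fun i => R.symm (x i))
  simpa using this.symm

/-- Invariance is extensional. [folklore] -/
theorem Inv.congr {A B : E3 → E3} (hA : Inv S A) (h : ∀ x, A x = B x) : Inv S B := by
  intro n x
  have := hA n x
  simpa [h] using this

/-- `B₃` generators give every `signedIso`. [folklore] -/
theorem inv_signedIso
    (hperm : ∀ (π : Equiv.Perm (Fin 3)) (n : ℕ) (x : Fin n → E3),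
      S n (fun i => LinearIsometryEquiv.piLpCongrLeft 2 ℝ ℝ π (x i)) = S n x)
    (hflip : ∀ (ε : Fin 3 → ℤˣ) (R : E3 ≃ₗᵢ[ℝ] E3), (∀ (p : E3) (j : Fin 3), R p j = ((ε j : ℤ) : ℝ) * p j) →
      ∀ (n : ℕ) (x : Fin n → E3), S n (fun i => R (x i)) = S n x)
    (π : Equiv.Perm (Fin 3)) (ε : Fin 3 → ℤˣ) : Inv S (signedIso π ε) := by
  have h1 : Inv S (LinearIsometryEquiv.piLpCongrLeft 2 ℝ ℝ π.symm) := fun n x => hperm π.symm n x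
  have h2 : Inv S (signedIso 1 ε) := by
    refine hflip ε (signedIso 1 ε) fun p j => ?_
    rw [signedIso_apply]; simp
  refine (h2.comp h1).congr fun x => ?_
  ext j
  rw [signedIso_apply, signedIso_apply]
  simp [MoebiusLimitExistsNegative.coordPerm_apply]

end Invariance

/-! ### The hex embedding `L_c` -/

/-- Matrix of the symmetric-gauge embedding `L_c`. [folklore] -/
def hexMat (c : ℝ) : Matrix (Fin 3) (Fin 3) ℝ := !![1, 1 / 2, 0; 0, Real.sqrt 3 / 2, 0; 0, 0, c]

/-- Matrix of `L_c⁻¹`. [folklore] -/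
def hexInvMat (c : ℝ) : Matrix (Fin 3) (Fin 3) ℝ :=
  !![1, -1 / Real.sqrt 3, 0; 0, 2 / Real.sqrt 3, 0; 0, 0, 1 / c]

/-- `L_c` in coordinates. [folklore] -/
theorem hex_lin_apply (c : ℝ) (v : E3) : rlin (hexMat c) v =
    WithLp.toLp 2 ![v 0 + v 1 / 2, Real.sqrt 3 / 2 * v 1, c * v 2] := by
  ext j; rw [rlin_apply]; (fin_cases j <;> simp [hexMat, Fin.sum_univ_three]); ring

/-- `L_c⁻¹` in coordinates. [folklore] -/
theorem hexInv_lin_apply (c : ℝ) (v : E3) : rlin (hexInvMat c) v =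
    WithLp.toLp 2 ![v 0 - v 1 / Real.sqrt 3, 2 / Real.sqrt 3 * v 1, v 2 / c] := by
  ext j; rw [rlin_apply]; fin_cases j <;> simp [hexInvMat, Fin.sum_univ_three] <;> ring

/-- `√3 ≠ 0` and `(√3)² = 3`. [folklore] -/
theorem sqrt3_facts : Real.sqrt 3 ≠ 0 ∧ Real.sqrt 3 ^ 2 = 3 :=
  ⟨by positivity, Real.sq_sqrt (by norm_num)⟩

/-- `L_c` as a continuous linear automorphism of `ℝ³` (`c ≠ 0`). [folklore] -/
def hexEmbed (c : ℝ) (hc : c ≠ 0) : E3 ≃L[ℝ] E3 :=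
  LinearEquiv.toContinuousLinearEquiv
    (LinearEquiv.ofLinear (rlin (hexMat c)) (rlin (hexInvMat c))
      (by
        apply LinearMap.ext; intro v
        obtain ⟨h0, h3⟩ := sqrt3_facts
        simp only [LinearMap.comp_apply, LinearMap.id_apply]
        rw [hexInv_lin_apply, hex_lin_apply]
        (ext j; fin_cases j <;> simp <;> field_simp); ring1)
      (by
        apply LinearMap.ext; intro v
        obtain ⟨h0, h3⟩ := sqrt3_facts
        simp only [LinearMap.comp_apply, LinearMap.id_apply]
        rw [hex_lin_apply, hexInv_lin_apply]
        (ext j; fin_cases j <;> simp <;> field_simp); ring1))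

/-- `L_c` in coordinates. [folklore] -/
theorem hexEmbed_apply (c : ℝ) (hc : c ≠ 0) (v : E3) :
    hexEmbed c hc v = WithLp.toLp 2 ![v 0 + v 1 / 2, Real.sqrt 3 / 2 * v 1, c * v 2] := by
  show rlin (hexMat c) v = _
  exact hex_lin_apply c v

/-- `L_c⁻¹` in coordinates. [folklore] -/
theorem hexEmbed_symm_apply (c : ℝ) (hc : c ≠ 0) (v : E3) :
    (hexEmbed c hc).symm v = WithLp.toLp 2 ![v 0 - v 1 / Real.sqrt 3, 2 / Real.sqrt 3 * v 1, v 2 / c] := by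
  show rlin (hexInvMat c) v = _
  exact hexInv_lin_apply c v

/-- **The transported sixfold map is `R_z(60°)` on the nose**: `L_c M̃ L_c⁻¹ = R_z(60°)`. [folklore] -/
theorem hexEmbed_conj_sixfold (c : ℝ) (hc : c ≠ 0) (x : E3) :
    hexEmbed c hc (zlin !![0, -1, 0; 1, 1, 0; 0, 0, 1] ((hexEmbed c hc).symm x)) = rz60 x := by
  obtain ⟨h0, h3⟩ := sqrt3_facts
  rw [hexEmbed_symm_apply, sixfold_apply, hexEmbed_apply, rz60_apply]
  ext j; fin_cases j
  · simp; field_simp; linear_combination (x 1) * h3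
  · simp; field_simp; ring1
  · simp; field_simp

/-- **Registered sub-goal `hexEmbedding_conj_sixfold`** (the `--supports` anchor of this
Defs-type file): in the symmetric gauge the transported sixfold map is `R_z(60°)`,
`L_c M̃ L_c⁻¹ = rz60`, for every axial scale `c ≠ 0`. [folklore] -/
theorem hexEmbedding_conj_sixfold :
    ∀ (c : ℝ) (hc : c ≠ 0) (x : EuclideanSpace ℝ (Fin 3)),
      hexEmbed c hc (zlin !![0, -1, 0; 1, 1, 0; 0, 0, 1] ((hexEmbed c hc).symm x)) = rz60 x :=
  hexEmbed_conj_sixfold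

end Summit.CriticalPhenomena.Ising3DConformalLimit.Cruxes.RotationUpgradeFromTwoPoint.TwoCrystalsGenerateSo3

end
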